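import Mathlib.Analysis.SpecialFunctions.Integrals.Basic
import Mathlib.Analysis.SpecialFunctions.Trigonometric.Bounds
import Mathlib.MeasureTheory.Integral.Pi
import Literature.Analysis.FunctionSpaces.TorusDirichletKernel
import HarnessLib

/-!
# Discharge of `Torus.dirichletKernel_Lp_bound`: `‖D_r‖_{L^p(T³)} ≤ C_p r^{3/2 - 3/p}`

Analysis/FunctionSpaces file, sibling of `Literature/Analysis/FunctionSpaces/TorusDirichletKernel`
(the normalised Dirichlet kernel `D_r = (2r+1)^{-d/2} ∑_{k ∈ Ω_r} e_k` of the frequency cube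
`Ω_r = {-r,…,r}^d` on `T^d = UnitAddTorus d`), PROVING its named fact
`Torus.dirichletKernel_Lp_bound` — Buckmaster–Vicol 2019, (3.7): "for `1 < p ≤ ∞` …
`‖D_r‖_{L^p} ≲ r^{3/2-3/p}`, where the implicit constant depends only on `p`" — along the
printed route (BV19 (3.6)–(3.7), citing Grafakos for the one-dimensional estimate). No new
definitions: the one-dimensional kernel is written as the explicit character sum
`D¹_r(t) = ∑_{j ∈ [-r,r]} e_j(t)` (`∑ j ∈ Finset.Icc (-r) r, fourier j t`) throughout.

1. **The one-dimensional Dirichlet kernel** `D¹_r(t) = ∑_{|j| ≤ r} e_j(t)` on `T = ℝ/ℤ`,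
   `e_j(y) = e^{2πijy}` (Grafakos 2014, (3.1.11)/Def. 3.1.6; BV19 (3.6) is the same kernel in
   the variable `x = 2πy`): `‖D¹_r‖ ≤ 2r+1`; on the lift `y ∈ ℝ`,
   `D¹_r(y) = e^{-2πiry} G_{2r+1}(y)` with the geometric sum `G_n(y) = ∑_{m<n} e^{2πimy}`,
   `‖G_n(y)‖ ≤ 1/|sin(πy)|` (`(e^{2πiy}-1)G_n = e^{2πiny}-1`, `|e^{2πiy}-1| = 2|sin(πy)|`; the
   geometric-sum form of Grafakos (3.1.15) `D_N = sin((2N+1)πy)/sin(πy)`), Jordan's inequality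
   `2|y| ≤ |sin(πy)|` on `|y| ≤ 1/2`, whence `‖D¹_r(y)‖ ≤ 1/(2|y|)`.
2. **The one-dimensional `L^p` estimate** `Torus.integral_norm_circleDirichlet_rpow_le`: for
   `1 < p < ∞`, `r ≥ 1`, `∫_T ‖D¹_r‖^p ≤ K_p r^{p-1}`, `K_p = 3^p + 2^p/(p-1)` — the upper half
   of Grafakos 2014, Exercise 3.1.6 (`‖D_N‖_{L^p} ≤ C_p (2N+1)^{1/p'}`) = BV19 (3.6)
   `‖D_n‖_{L^p} ∼ n^{1-1/p}`, with an explicit admissible constant: transfer to `∫_{-1/2}^{1/2}`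
   (`UnitAddCircle.intervalIntegral_preimage`), split at `±1/(2r)`, `‖D¹_r‖ ≤ 2r+1 ≤ 3r` in the
   middle, `‖D¹_r(y)‖^p ≤ |y|^{-p}` outside, `∫_a^{1/2} y^{-p} dy ≤ a^{1-p}/(p-1)`.
3. **Tensorisation** (Grafakos (3.1.14), `D^n_R(x) = ∏ⱼ D_R(xⱼ)`):
   `D_r(x) = (2r+1)^{-d/2} ∏ᵢ D¹_r(xᵢ)` (`Finset.prod_univ_sum`), so by Fubini on the product
   measure (`MeasureTheory.integral_fintype_prod_volume_eq_pow`)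
   `∫_{T^d} ‖D_r‖^p = (∫_T ‖D¹_r‖^p)^d ((2r+1)^{-d/2})^p` (`Torus.integral_norm_dirichletKernel_rpow`).
4. **Bookkeeping**: `(2r+1)^{-d/2} ≤ r^{-d/2}`, `(K r^{p-1})^d (r^{-d/2})^p = (K^{d/p} r^{d/2-d/p})^p`,
   `‖·‖_{L^p} = (∫‖·‖^p)^{1/p}` (`MemLp.eLpNorm_eq_integral_rpow_norm`): for every finite `d`,
   `‖D_r‖_{L^p(T^d)} ≤ K_p^{d/p} r^{d/2-d/p}` (`Torus.eLpNorm_dirichletKernel_le`); `d = Fin 3`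
   with `C = K_p^{3/p}` is **`Torus.dirichletKernel_Lp_bound_holds : Torus.dirichletKernel_Lp_bound`**.

Not here: the lower bound `c_p(2N+1)^{1/p'} ≤ ‖D_N‖_{L^p}` of Exercise 3.1.6 and the Lebesgue
constants (Exercise 3.1.5). The trigonometric-sum lemmas of step 1 in the variable `x = 2πy` on
`[-π,π]` also exist in `Literature/Barriers/CriticalPhenomena/LongRangeTrivialityOnZ3InfraredBoundFourier`
(`LongRangeIsing.dirichletKernel`: sup and `1/|sin|` bounds, no `L^p` integral); they are
re-proved in the `UnitAddCircle` normalisation rather than importing the barrier catalogue here.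

## References

* T. Buckmaster, V. Vicol, *Nonuniqueness of weak solutions to the Navier–Stokes equation*,
  Ann. of Math. 189 (2019) = arXiv:1709.10033, §3.2, (3.6)–(3.7). [`BuckmasterVicol2019AnnMath`]
* L. Grafakos, *Classical Fourier Analysis*, 3rd ed., GTM 249 (2014), §3.1.3: (3.1.11),
  Def. 3.1.6, (3.1.14)–(3.1.15), Exercise 3.1.6 (p. 182). [`Grafakos2014`]
* Mathlib: `fourier_coe_apply`, `geom_sum_eq`, `Complex.norm_exp_I_mul_ofReal_sub_one`,
  `Real.mul_le_sin`, `UnitAddCircle.intervalIntegral_preimage`, `integral_rpow`,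
  `MeasureTheory.integral_fintype_prod_volume_eq_pow`, `MemLp.eLpNorm_eq_integral_rpow_norm`.
-/

noncomputable section

open MeasureTheory Set Filter UnitAddTorus Complex
open scoped Real ENNReal

namespace Literature.Analysis.FunctionSpaces

namespace Torus

variable {d : Type*} [Fintype d] [DecidableEq d]

/-! ## The one-dimensional kernel `D¹_r = ∑_{j ∈ [-r,r]} e_j` and its sup bound -/

/-- `D¹_r = ∑_{|j| ≤ r} e_j` is continuous (a trigonometric polynomial). [folklore] -/
theorem continuous_circleDirichlet (r : ℕ) :
    Continuous fun t : UnitAddCircle => ∑ j ∈ Finset.Icc (-(r : ℤ)) r, fourier j t :=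
  continuous_finsetSum _ fun j _ => (fourier j).continuous

/-- `#{-r,…,r} = 2r+1`. [folklore] -/
theorem card_Icc_neg_self (r : ℕ) : (Finset.Icc (-(r : ℤ)) r).card = 2 * r + 1 := by
  rw [Int.card_Icc]; omega

/-- **Sup bound** `‖D¹_r(t)‖ ≤ 2r+1` (triangle inequality, `‖e_j‖ = 1`).
[cite: Grafakos2014, §3.1.3] -/
theorem norm_circleDirichlet_le (r : ℕ) (t : UnitAddCircle) :
    ‖∑ j ∈ Finset.Icc (-(r : ℤ)) r, fourier j t‖ ≤ 2 * r + 1 := by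
  refine (norm_sum_le _ _).trans ?_
  have h1 : ∀ j ∈ Finset.Icc (-(r : ℤ)) r, ‖fourier j t‖ = 1 := fun j _ => by
    rw [fourier_apply]; exact Circle.norm_coe _
  rw [Finset.sum_congr rfl h1, Finset.sum_const, card_Icc_neg_self, nsmul_eq_mul, mul_one]
  push_cast
  exact le_rfl

/-- The sup bound raised to the power `p ≥ 0`: `‖D¹_r(t)‖^p ≤ (2r+1)^p`. [folklore] -/
theorem norm_circleDirichlet_rpow_le {r : ℕ} {p : ℝ} (hp : 0 ≤ p) (t : UnitAddCircle) :
    ‖∑ j ∈ Finset.Icc (-(r : ℤ)) r, fourier j t‖ ^ p ≤ (2 * r + 1 : ℝ) ^ p :=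
  Real.rpow_le_rpow (norm_nonneg _) (norm_circleDirichlet_le r t) hp

/-! ## The lift to `ℝ`: geometric sum, `1/|sin(πy)|`, Jordan -/

/-- **Geometric sum bound** `‖∑_{m<n} e^{2πimy}‖ ≤ 1/|sin(πy)|` off the zeros of `sin(πy)`
(`(e^{2πiy}-1) G_n = e^{2πiny}-1`, `|e^{2πiy}-1| = 2|sin(πy)|`). [cite: Grafakos2014, (3.1.15)] -/
theorem norm_circleGeomSum_le_inv_abs_sin {y : ℝ} (h : Real.sin (π * y) ≠ 0) (n : ℕ) :
    ‖∑ m ∈ Finset.range n, Complex.exp (I * ((2 * π * y : ℝ) : ℂ)) ^ m‖ ≤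
      1 / |Real.sin (π * y)| := by
  set z : ℂ := Complex.exp (I * ((2 * π * y : ℝ) : ℂ)) with hz
  have hz1 : ‖z - 1‖ = 2 * |Real.sin (π * y)| := by
    rw [hz, Complex.norm_exp_I_mul_ofReal_sub_one, Real.norm_eq_abs, abs_mul, abs_two,
      show 2 * π * y / 2 = π * y by ring]
  have hzn : ‖z‖ = 1 := by rw [hz, mul_comm, Complex.norm_exp_ofReal_mul_I]
  have hs : 0 < |Real.sin (π * y)| := abs_pos.2 h
  have hne : z ≠ 1 := by
    intro h1
    have : ‖z - 1‖ = 0 := by rw [h1, sub_self, norm_zero]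
    rw [hz1] at this
    linarith
  rw [geom_sum_eq hne n, norm_div, hz1]
  have hnum : ‖z ^ n - 1‖ ≤ 2 := by
    refine (norm_sub_le _ _).trans ?_
    rw [norm_pow, hzn, one_pow, norm_one]; norm_num
  rw [div_le_div_iff₀ (by positivity) hs]
  nlinarith

/-- On the lift, `D¹_r(y) = ∑_{j=-r}^{r} e^{2πijy}`. [cite: Grafakos2014, (3.1.11)] -/
theorem circleDirichlet_coe (r : ℕ) (y : ℝ) :
    (∑ j ∈ Finset.Icc (-(r : ℤ)) r, fourier j (y : UnitAddCircle)) =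
      ∑ j ∈ Finset.Icc (-(r : ℤ)) r, Complex.exp (2 * π * I * j * y) := by
  refine Finset.sum_congr rfl fun j _ => ?_
  rw [fourier_coe_apply, Complex.ofReal_one, div_one]

/-- `D¹_r(y) = e^{-2πiry} ∑_{m ≤ 2r} e^{2πimy}` (first step of Grafakos (3.1.15)).
[cite: Grafakos2014, (3.1.15)] -/
theorem circleDirichlet_coe_eq_geomSum (r : ℕ) (y : ℝ) :
    (∑ j ∈ Finset.Icc (-(r : ℤ)) r, fourier j (y : UnitAddCircle)) =
      Complex.exp (-(2 * π * I * r * y)) *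
        ∑ m ∈ Finset.range (2 * r + 1), Complex.exp (I * ((2 * π * y : ℝ) : ℂ)) ^ m := by
  rw [circleDirichlet_coe]
  have himage : Finset.Icc (-(r : ℤ)) r =
      (Finset.range (2 * r + 1)).image fun m : ℕ => (m : ℤ) - r := by
    ext j
    simp only [Finset.mem_Icc, Finset.mem_image, Finset.mem_range]
    constructor
    · rintro ⟨h1, h2⟩
      refine ⟨(j + r).toNat, ?_, ?_⟩ <;> omega
    · rintro ⟨m, hm, rfl⟩; omega
  rw [himage, Finset.sum_image (fun m _ m' _ h => by simpa using h), Finset.mul_sum]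
  refine Finset.sum_congr rfl fun m _ => ?_
  rw [← Complex.exp_nat_mul, ← Complex.exp_add]
  congr 1
  push_cast
  ring

/-- `‖D¹_r(y)‖ = ‖∑_{m ≤ 2r} e^{2πimy}‖`. [folklore] -/
theorem norm_circleDirichlet_coe (r : ℕ) (y : ℝ) :
    ‖∑ j ∈ Finset.Icc (-(r : ℤ)) r, fourier j (y : UnitAddCircle)‖ =
      ‖∑ m ∈ Finset.range (2 * r + 1), Complex.exp (I * ((2 * π * y : ℝ) : ℂ)) ^ m‖ := by
  rw [circleDirichlet_coe_eq_geomSum, norm_mul, Complex.norm_exp]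
  simp

/-- **Jordan's inequality on the fundamental domain**: `2|y| ≤ |sin(πy)|` for `|y| ≤ 1/2`.
[folklore] -/
theorem two_mul_abs_le_abs_sin_pi_mul {y : ℝ} (hy : |y| ≤ 1 / 2) :
    2 * |y| ≤ |Real.sin (π * y)| := by
  have hπ := Real.pi_pos
  have h0 : 0 ≤ π * |y| := by positivity
  have h1 : π * |y| ≤ π / 2 := by nlinarith
  have h := Real.mul_le_sin h0 h1
  have h2 : 2 / π * (π * |y|) = 2 * |y| := by field_simp
  have h3 : Real.sin (π * |y|) = |Real.sin (π * y)| := by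
    rcases abs_choice y with h | h
    · rw [h, abs_of_nonneg]
      have hy0 : 0 ≤ y := by rw [← h]; exact abs_nonneg y
      exact Real.sin_nonneg_of_nonneg_of_le_pi (by positivity) (by nlinarith)
    · rw [h, mul_neg, Real.sin_neg, abs_of_nonpos]
      have hy0 : y ≤ 0 := by linarith [abs_nonneg y]
      have : π * y ≤ 0 := mul_nonpos_of_nonneg_of_nonpos hπ.le hy0
      exact Real.sin_nonpos_of_nonpos_of_neg_pi_le this (by nlinarith [abs_nonneg y])
  linarith

/-- **`‖D¹_r(y)‖ ≤ 1/(2|y|)` for `0 < |y| ≤ 1/2`** (geometric sum + Jordan).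
[cite: Grafakos2014, Exercise 3.1.6] -/
theorem norm_circleDirichlet_coe_le_inv {r : ℕ} {y : ℝ} (hy : |y| ≤ 1 / 2) (hy0 : y ≠ 0) :
    ‖∑ j ∈ Finset.Icc (-(r : ℤ)) r, fourier j (y : UnitAddCircle)‖ ≤ 1 / (2 * |y|) := by
  have hj := two_mul_abs_le_abs_sin_pi_mul hy
  have hs_pos : 0 < |Real.sin (π * y)| := lt_of_lt_of_le (by positivity) hj
  rw [norm_circleDirichlet_coe]
  refine (norm_circleGeomSum_le_inv_abs_sin (abs_pos.1 hs_pos) _).trans ?_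
  exact one_div_le_one_div_of_le (by positivity) hj

/-- The `L^p` majorant off the origin: `‖D¹_r(y)‖^p ≤ |y|^{-p}` for `0 < |y| ≤ 1/2`, `p ≥ 0`.
[cite: Grafakos2014, Exercise 3.1.6] -/
theorem norm_circleDirichlet_coe_rpow_le {r : ℕ} {p y : ℝ} (hp : 0 ≤ p) (hy : |y| ≤ 1 / 2)
    (hy0 : y ≠ 0) :
    ‖∑ j ∈ Finset.Icc (-(r : ℤ)) r, fourier j (y : UnitAddCircle)‖ ^ p ≤ |y| ^ (-p) := by
  have hya : 0 < |y| := abs_pos.2 hy0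
  have h1 : ‖∑ j ∈ Finset.Icc (-(r : ℤ)) r, fourier j (y : UnitAddCircle)‖ ≤ |y|⁻¹ := by
    refine (norm_circleDirichlet_coe_le_inv hy hy0).trans ?_
    rw [one_div]
    exact inv_anti₀ hya (by linarith)
  calc ‖∑ j ∈ Finset.Icc (-(r : ℤ)) r, fourier j (y : UnitAddCircle)‖ ^ p
      ≤ |y|⁻¹ ^ p := Real.rpow_le_rpow (norm_nonneg _) h1 hp
    _ = |y| ^ (-p) := by rw [Real.inv_rpow hya.le, Real.rpow_neg hya.le]

/-! ## The one-dimensional `L^p` integral -/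

/-- `∫_a^{1/2} y^{-p} dy ≤ a^{1-p}/(p-1)` for `0 < a ≤ 1/2`, `p > 1`. [folklore] -/
theorem integral_rpow_neg_le {a p : ℝ} (ha : 0 < a) (ha2 : a ≤ 1 / 2) (hp : 1 < p) :
    ∫ y in a..(1 / 2 : ℝ), y ^ (-p) ≤ a ^ (1 - p) / (p - 1) := by
  have h0 : (0 : ℝ) ∉ Set.uIcc a (1 / 2) := by
    rw [Set.uIcc_of_le ha2]
    intro h
    exact absurd (ha.trans_le h.1) (lt_irrefl 0)
  rw [integral_rpow (Or.inr ⟨by linarith, h0⟩)]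
  have hp1 : 0 < p - 1 := by linarith
  rw [show a ^ (1 - p) = a ^ (-(p - 1)) by congr 1; ring,
    show -p + 1 = -(p - 1) by ring, div_neg, neg_div', neg_sub]
  have hX : 0 ≤ (1 / 2 : ℝ) ^ (-(p - 1)) := by positivity
  exact div_le_div_of_nonneg_right (by linarith [hX]) hp1.le

/-- **Grafakos 2014, Exercise 3.1.6 (upper bound) / Buckmaster–Vicol 2019, (3.6)**: for
`1 < p < ∞` and `r ≥ 1`, `∫_T ‖D¹_r‖^p ≤ (3^p + 2^p/(p-1)) r^{p-1}`, i.e.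
`‖D¹_r‖_{L^p(T)} ≤ C_p r^{1-1/p}`. [cite: Grafakos2014, Exercise 3.1.6] -/
theorem integral_norm_circleDirichlet_rpow_le {p : ℝ} (hp : 1 < p) {r : ℕ} (hr : 1 ≤ r) :
    ∫ t : UnitAddCircle, ‖∑ j ∈ Finset.Icc (-(r : ℤ)) r, fourier j t‖ ^ p ≤
      (3 ^ p + 2 ^ p / (p - 1)) * (r : ℝ) ^ (p - 1) := by
  have hp0 : 0 ≤ p := by linarith
  have hp1 : 0 < p - 1 := by linarith
  have hr1 : (1 : ℝ) ≤ r := by exact_mod_cast hr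
  have hr0 : (0 : ℝ) < r := by linarith
  set F : ℝ → ℝ := fun y =>
    ‖∑ j ∈ Finset.Icc (-(r : ℤ)) r, fourier j (y : UnitAddCircle)‖ ^ p
  have hFc : Continuous F :=
    ((continuous_circleDirichlet r).comp (AddCircle.continuous_mk' 1)).norm.rpow_const
      fun _ => Or.inr hp0
  have hint : ∀ u v : ℝ, IntervalIntegrable F volume u v := fun u v => hFc.intervalIntegrable u v
  -- transfer to the fundamental domain `[-1/2, 1/2]`
  have h0 : ∫ t : UnitAddCircle, ‖∑ j ∈ Finset.Icc (-(r : ℤ)) r, fourier j t‖ ^ p =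
      ∫ y in (-(1 / 2) : ℝ)..(1 / 2), F y := by
    rw [← UnitAddCircle.intervalIntegral_preimage (-(1 / 2))
        fun t => ‖∑ j ∈ Finset.Icc (-(r : ℤ)) r, fourier j t‖ ^ p,
      show (-(1 / 2) : ℝ) + 1 = 1 / 2 by norm_num]
  -- the splitting point `a = 1/(2r)`
  set a : ℝ := 1 / (2 * r) with ha
  have ha0 : 0 < a := by positivity
  have ha2 : a ≤ 1 / 2 := by
    rw [ha]; exact one_div_le_one_div_of_le (by norm_num) (by linarith)
  have hapow : a ^ (1 - p) / (p - 1) = 2 ^ (p - 1) / (p - 1) * (r : ℝ) ^ (p - 1) := by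
    rw [ha, one_div, Real.inv_rpow (by positivity), ← Real.rpow_neg (by positivity), neg_sub,
      Real.mul_rpow (by norm_num) hr0.le]
    ring
  -- pointwise majorant on `[a, 1/2]`, for `F` and for its reflection
  have hmaj : ∀ y ∈ Set.Icc a (1 / 2), F y ≤ y ^ (-p) ∧ F (-y) ≤ y ^ (-p) := by
    intro y hy
    have hy0 : 0 < y := ha0.trans_le hy.1
    have hyabs : |y| ≤ 1 / 2 := by rw [abs_of_pos hy0]; exact hy.2
    have h1 := norm_circleDirichlet_coe_rpow_le (r := r) hp0 hyabs hy0.ne'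
    have h2 := norm_circleDirichlet_coe_rpow_le (r := r) hp0 (y := -y) (by rwa [abs_neg])
      (neg_ne_zero.2 hy0.ne')
    rw [abs_of_pos hy0] at h1
    rw [abs_neg, abs_of_pos hy0] at h2
    exact ⟨h1, h2⟩
  have hrpow_int : IntervalIntegrable (fun y : ℝ => y ^ (-p)) volume a (1 / 2) :=
    intervalIntegral.intervalIntegrable_rpow (Or.inr (by
      rw [Set.uIcc_of_le ha2]; exact fun h => absurd (ha0.trans_le h.1) (lt_irrefl 0)))
  -- right piece
  have hright : ∫ y in a..(1 / 2), F y ≤ 2 ^ (p - 1) / (p - 1) * (r : ℝ) ^ (p - 1) := by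
    rw [← hapow]
    refine (intervalIntegral.integral_mono_on ha2 (hint _ _) hrpow_int
      fun y hy => (hmaj y hy).1).trans (integral_rpow_neg_le ha0 ha2 hp)
  -- left piece, by reflection
  have hleft : ∫ y in (-(1 / 2) : ℝ)..(-a), F y ≤ 2 ^ (p - 1) / (p - 1) * (r : ℝ) ^ (p - 1) := by
    rw [← hapow, ← intervalIntegral.integral_comp_neg]
    refine (intervalIntegral.integral_mono_on ha2 ((hFc.comp continuous_neg).intervalIntegrable _ _)
      hrpow_int fun y hy => (hmaj y hy).2).trans (integral_rpow_neg_le ha0 ha2 hp)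
  -- middle piece
  have hmid : ∫ y in (-a)..a, F y ≤ 3 ^ p * (r : ℝ) ^ (p - 1) := by
    have h1 : ∫ y in (-a)..a, F y ≤ ∫ _ in (-a)..a, (2 * r + 1 : ℝ) ^ p :=
      intervalIntegral.integral_mono_on (by linarith) (hint _ _) intervalIntegrable_const
        fun y _ => norm_circleDirichlet_rpow_le hp0 _
    rw [intervalIntegral.integral_const, smul_eq_mul] at h1
    have h3 : (a - -a) * (3 * r : ℝ) ^ p = 3 ^ p * (r : ℝ) ^ (p - 1) := by
      rw [Real.mul_rpow (by norm_num) hr0.le, Real.rpow_sub_one hr0.ne', ha]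
      field_simp
      ring
    calc ∫ y in (-a)..a, F y ≤ (a - -a) * (2 * r + 1 : ℝ) ^ p := h1
      _ ≤ (a - -a) * (3 * r : ℝ) ^ p :=
        mul_le_mul_of_nonneg_left (Real.rpow_le_rpow (by positivity) (by linarith) hp0)
          (by linarith)
      _ = 3 ^ p * (r : ℝ) ^ (p - 1) := h3
  -- assemble
  have hsplit : ∫ y in (-(1 / 2) : ℝ)..(1 / 2), F y =
      ((∫ y in (-(1 / 2) : ℝ)..(-a), F y) + ∫ y in (-a)..a, F y) + ∫ y in a..(1 / 2), F y := by
    rw [intervalIntegral.integral_add_adjacent_intervals (hint _ _) (hint _ _),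
      intervalIntegral.integral_add_adjacent_intervals (hint _ _) (hint _ _)]
  have h2p : (2 : ℝ) ^ p = 2 * 2 ^ (p - 1) := by
    rw [Real.rpow_sub_one two_ne_zero]; ring
  rw [h0, hsplit, h2p]
  calc ((∫ y in (-(1 / 2) : ℝ)..(-a), F y) + ∫ y in (-a)..a, F y) + ∫ y in a..(1 / 2), F y
      ≤ (2 ^ (p - 1) / (p - 1) * (r : ℝ) ^ (p - 1) + 3 ^ p * (r : ℝ) ^ (p - 1)) +
          2 ^ (p - 1) / (p - 1) * (r : ℝ) ^ (p - 1) := by gcongr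
    _ = (3 ^ p + 2 * 2 ^ (p - 1) / (p - 1)) * (r : ℝ) ^ (p - 1) := by ring

/-! ## Tensorisation and Fubini -/

/-- **Tensorisation of the cube Dirichlet kernel** (Grafakos (3.1.14)):
`D_r(x) = (∏ᵢ D¹_r(xᵢ)) · (2r+1)^{-d/2}`. [cite: Grafakos2014, (3.1.14)] -/
theorem dirichletKernel_eq_prod_mul (r : ℕ) (x : UnitAddTorus d) :
    dirichletKernel r x =
      (∏ i, ∑ j ∈ Finset.Icc (-(r : ℤ)) r, fourier j (x i)) * (((dirichletNorm d r)⁻¹ : ℝ) : ℂ) := by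
  rw [dirichletKernel_apply, ← Finset.sum_mul]
  congr 1
  have h : ∀ k : d → ℤ, mFourier k x = ∏ i, fourier (k i) (x i) := fun k => rfl
  simp_rw [h, freqCube, Finset.prod_univ_sum]

/-- `‖D_r(x)‖ = (∏ᵢ ‖D¹_r(xᵢ)‖) · (2r+1)^{-d/2}`. [cite: Grafakos2014, (3.1.14)] -/
theorem norm_dirichletKernel_eq (r : ℕ) (x : UnitAddTorus d) :
    ‖dirichletKernel r x‖ =
      (∏ i, ‖∑ j ∈ Finset.Icc (-(r : ℤ)) r, fourier j (x i)‖) * (dirichletNorm d r)⁻¹ := by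
  rw [dirichletKernel_eq_prod_mul, norm_mul, norm_prod, Complex.norm_real, Real.norm_eq_abs,
    abs_of_pos (inv_pos.2 (dirichletNorm_pos r))]

/-- `‖D_r(x)‖^p = (∏ᵢ ‖D¹_r(xᵢ)‖^p) · ((2r+1)^{-d/2})^p`. [folklore] -/
theorem norm_dirichletKernel_rpow_eq (r : ℕ) (x : UnitAddTorus d) (p : ℝ) :
    ‖dirichletKernel r x‖ ^ p =
      (∏ i, ‖∑ j ∈ Finset.Icc (-(r : ℤ)) r, fourier j (x i)‖ ^ p) * (dirichletNorm d r)⁻¹ ^ p := by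
  rw [norm_dirichletKernel_eq, Real.mul_rpow (Finset.prod_nonneg fun i _ => norm_nonneg _)
      (inv_nonneg.2 (dirichletNorm_pos r).le),
    Real.finsetProd_rpow _ _ (fun i _ => norm_nonneg _)]

/-- **Fubini for the tensorised kernel**: `∫_{T^d} ‖D_r‖^p = (∫_T ‖D¹_r‖^p)^d · ((2r+1)^{-d/2})^p`.
[cite: Grafakos2014, (3.1.14)] -/
theorem integral_norm_dirichletKernel_rpow (r : ℕ) (p : ℝ) :
    ∫ x, ‖dirichletKernel (d := d) r x‖ ^ p =
      (∫ t : UnitAddCircle, ‖∑ j ∈ Finset.Icc (-(r : ℤ)) r, fourier j t‖ ^ p) ^ Fintype.card d *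
        (dirichletNorm d r)⁻¹ ^ p := by
  simp_rw [norm_dirichletKernel_rpow_eq]
  rw [integral_mul_const]
  congr 1
  exact MeasureTheory.integral_fintype_prod_volume_eq_pow (ι := d)
    fun t : UnitAddCircle => ‖∑ j ∈ Finset.Icc (-(r : ℤ)) r, fourier j t‖ ^ p

/-! ## `L^p` membership and the `L^p` norm as an integral -/

/-- `D_r ∈ L^p(T^d)` for every `p` (smooth on a compact probability space). [folklore] -/
theorem memLp_dirichletKernel (r : ℕ) (p : ℝ≥0∞) : MemLp (dirichletKernel (d := d) r) p volume :=
  (isSmooth_dirichletKernel r).memLp p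

/-- `‖D_r‖_{L^p} = (∫ ‖D_r‖^p)^{1/p}` for `0 < p < ∞`. [folklore] -/
theorem eLpNorm_dirichletKernel_eq (r : ℕ) {p : ℝ} (hp : 0 < p) :
    eLpNorm (dirichletKernel (d := d) r) (ENNReal.ofReal p) volume =
      ENNReal.ofReal ((∫ x, ‖dirichletKernel (d := d) r x‖ ^ p) ^ p⁻¹) := by
  rw [(memLp_dirichletKernel (d := d) r (ENNReal.ofReal p)).eLpNorm_eq_integral_rpow_norm
    (ENNReal.ofReal_pos.2 hp).ne' ENNReal.ofReal_ne_top, ENNReal.toReal_ofReal hp.le]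

/-! ## Bookkeeping of exponents -/

omit [DecidableEq d] in
/-- `(2r+1)^{-d/2} ≤ r^{-d/2}` for `r ≥ 1`. [folklore] -/
theorem inv_dirichletNorm_le {r : ℕ} (hr : 1 ≤ r) :
    (dirichletNorm d r)⁻¹ ≤ (r : ℝ) ^ (-((Fintype.card d : ℝ) / 2)) := by
  have hr1 : (1 : ℝ) ≤ r := by exact_mod_cast hr
  have hr0 : (0 : ℝ) < r := by linarith
  rw [Real.rpow_neg hr0.le]
  refine inv_anti₀ (by positivity) ?_
  rw [dirichletNorm, Real.sqrt_eq_rpow, ← Real.rpow_natCast, ← Real.rpow_mul (by positivity),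
    mul_one_div]
  exact Real.rpow_le_rpow hr0.le (by linarith) (by positivity)

/-- Exponent bookkeeping: `(K r^{p-1})^n (r^{-n/2})^p = (K^{n/p} r^{n/2-n/p})^p`. [folklore] -/
theorem rpow_bookkeeping {K r p : ℝ} (hK : 0 < K) (hr : 0 < r) (hp : p ≠ 0) (n : ℕ) :
    (K * r ^ (p - 1)) ^ n * (r ^ (-((n : ℝ) / 2))) ^ p =
      (K ^ ((n : ℝ) / p) * r ^ ((n : ℝ) / 2 - (n : ℝ) / p)) ^ p := by
  rw [← Real.rpow_natCast]
  conv => rw [← Real.exp_log hK, ← Real.exp_log hr]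
  simp only [← Real.exp_mul, ← Real.exp_add]
  congr 1
  field_simp
  ring

/-! ## The `L^p` bound in every dimension, and the discharge -/

/-- **`‖D_r‖_{L^p(T^d)} ≤ K_p^{d/p} r^{d/2 - d/p}`** for `1 < p < ∞`, `r ≥ 1`,
`K_p = 3^p + 2^p/(p-1)` — the printed `‖D_r‖_{L^p} ≲ r^{3/2-3/p}` in any finite dimension `d`.
[cite: BuckmasterVicol2019AnnMath, §3.2 (3.7)] -/
theorem eLpNorm_dirichletKernel_le {p : ℝ} (hp : 1 < p) {r : ℕ} (hr : 1 ≤ r) :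
    eLpNorm (dirichletKernel (d := d) r) (ENNReal.ofReal p) volume ≤
      ENNReal.ofReal ((3 ^ p + 2 ^ p / (p - 1)) ^ ((Fintype.card d : ℝ) / p) *
        (r : ℝ) ^ ((Fintype.card d : ℝ) / 2 - (Fintype.card d : ℝ) / p)) := by
  have hp0 : 0 < p := by linarith
  have hK : 0 < (3 : ℝ) ^ p + 2 ^ p / (p - 1) :=
    add_pos (by positivity) (div_pos (by positivity) (by linarith))
  have hr0 : (0 : ℝ) < r := by exact_mod_cast hr
  set n : ℕ := Fintype.card d
  set K : ℝ := 3 ^ p + 2 ^ p / (p - 1)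
  have hI1 := integral_norm_circleDirichlet_rpow_le hp hr
  have hI1_nn : 0 ≤ ∫ t : UnitAddCircle, ‖∑ j ∈ Finset.Icc (-(r : ℤ)) r, fourier j t‖ ^ p :=
    integral_nonneg fun t => by positivity
  have hI : ∫ x, ‖dirichletKernel (d := d) r x‖ ^ p ≤
      (K ^ ((n : ℝ) / p) * (r : ℝ) ^ ((n : ℝ) / 2 - (n : ℝ) / p)) ^ p := by
    rw [integral_norm_dirichletKernel_rpow, ← rpow_bookkeeping hK hr0 hp0.ne' n]
    exact mul_le_mul (pow_le_pow_left₀ hI1_nn hI1 n)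
      (Real.rpow_le_rpow (inv_nonneg.2 (dirichletNorm_pos r).le) (inv_dirichletNorm_le hr) hp0.le)
      (Real.rpow_nonneg (inv_nonneg.2 (dirichletNorm_pos r).le) _) (by positivity)
  have hI_nn : 0 ≤ ∫ x, ‖dirichletKernel (d := d) r x‖ ^ p := integral_nonneg fun x => by positivity
  rw [eLpNorm_dirichletKernel_eq r hp0]
  refine ENNReal.ofReal_le_ofReal ?_
  calc (∫ x, ‖dirichletKernel (d := d) r x‖ ^ p) ^ p⁻¹
      ≤ ((K ^ ((n : ℝ) / p) * (r : ℝ) ^ ((n : ℝ) / 2 - (n : ℝ) / p)) ^ p) ^ p⁻¹ :=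
        Real.rpow_le_rpow hI_nn hI (inv_nonneg.2 hp0.le)
    _ = K ^ ((n : ℝ) / p) * (r : ℝ) ^ ((n : ℝ) / 2 - (n : ℝ) / p) :=
        Real.rpow_rpow_inv (by positivity) hp0.ne'

/-- **Discharge of the named fact `Torus.dirichletKernel_Lp_bound`** (Buckmaster–Vicol 2019,
(3.7); Luo–Titi 2020, §3.2): for `1 < p < ∞` there is `C = C(p) > 0` with
`‖D_r‖_{L^p(T³)} ≤ C r^{3/2 - 3/p}` for all `r ≥ 1`; here `C = (3^p + 2^p/(p-1))^{3/p}`.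
[cite: BuckmasterVicol2019AnnMath, §3.2 (3.7)] -/
theorem dirichletKernel_Lp_bound_holds : dirichletKernel_Lp_bound := by
  intro p hp
  have hK : 0 < (3 : ℝ) ^ p + 2 ^ p / (p - 1) :=
    add_pos (by positivity) (div_pos (by positivity) (by linarith))
  refine ⟨(3 ^ p + 2 ^ p / (p - 1)) ^ ((3 : ℝ) / p), Real.rpow_pos_of_pos hK _, fun r hr => ?_⟩
  have h := eLpNorm_dirichletKernel_le (d := Fin 3) hp hr
  simpa only [Fintype.card_fin, Nat.cast_ofNat] using h

end Torus

end Literature.Analysis.FunctionSpaces
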